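/-
Copyright (c) 2026 the pub-hodgecm-mathlib formalisation cell (harness21).  Prover seat hodgecm-mathlib-K2E3-p21 (g7), HCML Track B «K2-LIT» ∕ h413
(`stmt-HodgeConjecture-24833`), line `K2_E3_EllipticInputs`, leaf (nsc-S-A′), brick (E4b) = discharge of `h3cell` of ★ E4a, part (E4b-1β) MIDDLE CELL (dealer D107) — THE PAYER:
letter L1 of K2E3-p03 (E4b-3 ★ `K2E3GL3WeakCellLemma`, consumer ★ `K2E3GL3PrincipalSeriesThreeCell.ncq_jacquetGL_twoOne_of_middle_of_open`), byte for byte.  2026-09-04.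
-/
import Summits.HodgeConjecture.HodgeConjecture.Theorems.K2E3GL3BorelInducedJacquetQMiddleCellMap      -- ★ file 2 (this seat, p860238): `exists_middleCellMap_formula`, `exists_borelMultiplier`
import Summits.HodgeConjecture.HodgeConjecture.Theorems.K2E3GL3BorelInducedJacquetQMiddleCellKernel   -- ★ file 3b (this seat, p860330): `exists_mem_vanishingOn_minor_of_integral_eq_zero`
import HarnessLib

/-!
# K2_E3 road (h413), leaf (nsc-S-A′), brick (E4b-1β) — THE MIDDLE-CELL LETTER L1: `Ψ₁ : J₁ → I₂(χ₂)`, `GL₂`-EQUIVARIANT, WITH `ker Ψ₁ ⊆ [X²]`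

Cell `pub/hodgecm-mathlib` (D-0151), Track B, seat K2E3-p21 (g7).  `--supports stmt-HodgeConjecture-24833 --as helper`; THEOREMS ONLY; COUNT-NEUTRAL.

THE MATHEMATICS ([BernsteinZelevinsky1977, Thm. 5.2 (geometric lemma), middle `(B, P_{(2,1)})`-orbit]; [Casselman1995, §6.3]).  For the principal series
`I χ = Ind_{B₃}^{GL₃}(χ δ^{1∕2})` (`= parabolicIndGL F id (𝟙.twist χ)`), a continuous block embedding `ι : GL₂ → M_{(2,1)}` (`diag(ι g) = diag(g, 1)`), and the
subrepresentation `J₁ ≤ r_{(2,1)}(I χ)` of classes of functions vanishing on `P_{(2,1)}`: **`exists_middleCellMap`** — there are a character `χ₂` of the diagonal torus of `GL₂` and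
a linear `Ψ : J₁ → I₂(χ₂) = Ind_{B₂}^{GL₂}(χ₂ δ^{1∕2})` with `Ψ(ι(g)·a) = g·Ψ(a)` and `Ψ a = 0 ⇒ a ∈ [X²]`, `X² = {f : f|_Z = 0}`, `Z = {g₁₀g₂₁ = g₁₁g₂₀}`.
`Ψ[f](g) = ∫_F f(s₂ x₁₂(y) diag(ι g)) dy` (★ file 2, Mathlib's `Measure.addHaar` on `F`, coordinates of ★ `exists_coordHomeomorph`); the kernel clause is ★ file 3b once the
hypothesis `Ψ[f] ≡ 0` on `diag(ι GL₂)` is spread over all of `P = U_P · diag(M₁) · diag(ι GL₂)` (★ 1α′ `exists_eq_mul_iota`, ★ file 1 `U`-invariance, ★ file 2 Borel multiplier):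
`integral_middleCellFun_eq_zero_of_blockMap`.  The head is letter L1 of ★ E4b-3 BYTE FOR BYTE (the body of the consumer's hypothesis `h1`, `χ` as the leading binder).

HONEST LABEL: HC_CM is proved only modulo the 7 printed citations (2 remaining named inputs: hLiu418 = stmt-HodgeConjecture-24832, h413 = stmt-HodgeConjecture-24833) until
rung 0 closes; count-neutral helper.

## Mathlib ∕ tree search
★ file 2 `exists_middleCellMap_formula`, `exists_borelMultiplier` · ★ file 3b `exists_mem_vanishingOn_minor_of_integral_eq_zero` · ★ file 1 `integral_middleCellFun_mul_unipotent` · ★ 1α′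
`exists_eq_mul_iota` · ★ `exists_coordHomeomorph` · Mathlib `MeasureTheory.Measure.addHaar`.  Dedup: `lean search 'exists_middleCellMap'` — only ★ file 2's `_formula`.

## References
* [BernsteinZelevinsky1977] I. N. Bernstein, A. V. Zelevinsky, *Induced representations of reductive p-adic groups I*, Ann. Sci. ÉNS 10 (1977), Thm. 5.2.
* [Casselman1995] W. Casselman, *Introduction to the theory of admissible representations of p-adic reductive groups* (draft 1995), §6.3 (Thm. 6.3.5).
-/

set_option autoImplicit false
set_option linter.dupNamespace false

noncomputable section

open Set Function MeasureTheory Measure Representation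
open scoped MatrixGroups

namespace Summit.HodgeConjecture.HodgeConjecture.Cruxes.H413.K2E3GL3BorelInducedJacquetQMiddleCell

open Literature.NumberTheory.Automorphic ValuativeRel
open Literature.NumberTheory.GaloisRepresentations Literature.NumberTheory.GaloisRepresentations.IsNonarchimedeanLocalField
open Summit.HodgeConjecture.HodgeConjecture.Cruxes.H413.K2E3GL3BorelUnipotentHaar
open Summit.HodgeConjecture.HodgeConjecture.Cruxes.H413.K2E3GL3BruhatCellFunctionals
open Summit.HodgeConjecture.HodgeConjecture.Cruxes.H413.K2E3GL3BorelInducedJacquetQFiltration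
open Summit.HodgeConjecture.HodgeConjecture.Cruxes.H413.K2E3GL3BorelInducedJacquetQClosedCellGL2
open Summit.HodgeConjecture.HodgeConjecture.Cruxes.H413.K2E3GL3BorelInducedJacquetQMiddleCellIntegrand
open Summit.HodgeConjecture.HodgeConjecture.Cruxes.H413.K2E3GL3BorelInducedJacquetQMiddleCellMap
open Summit.HodgeConjecture.HodgeConjecture.Cruxes.H413.K2E3GL3BorelInducedJacquetQMiddleCellKernel

variable {F : Type} [Field F] [ValuativeRel F] [TopologicalSpace F] [IsNonarchimedeanLocalField F]

/-- From `Ψ₁[f] ≡ 0` on `diag(ι GL₂)` to `∫ f(s₂ x₁₂(y) p) dy = 0` for ALL `p ∈ P_{(2,1)}`: `p = u · diag(z) · diag(ι g)` with `u ∈ U_P`, `diag(z) ∈ B₃` (★ 1α′ `exists_eq_mul_iota`),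
and the integral is `U`-invariant (★ file 1) and `B₃`-covariant (★ file 2 `exists_borelMultiplier`). [cite: BernsteinZelevinsky1977, Thm. 5.2] -/
theorem integral_middleCellFun_eq_zero_of_blockMap [MeasurableSpace F] [BorelSpace F] (μ : Measure F) [μ.IsAddHaarMeasure]
    (χ : (Π a : Fin 3, GL {i : Fin 3 // (id : Fin 3 → Fin 3) i = a} F) →* ℂˣ)
    (e : (F × F) × F ≃ₜ ↥(unipotentRadicalGL F (id : Fin 3 → Fin 3)))
    (he : ∀ p : (F × F) × F, (((e p : ↥(unipotentRadicalGL F (id : Fin 3 → Fin 3))) : GL (Fin 3) F) : Matrix (Fin 3) (Fin 3) F) = !![1, p.1.1, p.2; 0, 1, p.1.2; 0, 0, 1])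
    (ι : GL (Fin 2) F →* (Π a : Fin 2, GL {i : Fin 3 // (![0, 0, 1] : Fin 3 → Fin 2) i = a} F))
    (hι : ∀ g : GL (Fin 2) F, (((blockDiagonalGL F (![0, 0, 1] : Fin 3 → Fin 2)) (ι g) : GL (Fin 3) F) : Matrix (Fin 3) (Fin 3) F) = !![(g : Matrix (Fin 2) (Fin 2) F) 0 0, (g : Matrix (Fin 2) (Fin 2) F) 0 1, 0; (g : Matrix (Fin 2) (Fin 2) F) 1 0, (g : Matrix (Fin 2) (Fin 2) F) 1 1, 0; 0, 0, 1])
    (f : SmoothInd (standardParabolicGL F (id : Fin 3 → Fin 3)) (Representation.twist (((Representation.trivial ℂ (Π a : Fin 3, GL {i : Fin 3 // (id : Fin 3 → Fin 3) i = a} F) ℂ).twist χ).comp (leviProjection F (id : Fin 3 → Fin 3))) (rootDeltaChar (standardParabolicGL F (id : Fin 3 → Fin 3)))))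
    (hzero : ∀ g : GL (Fin 2) F, ∫ y, f.toFun ((permGL (Equiv.swap (1 : Fin 3) 2) : GL (Fin 3) F) * ((e ((0, y), 0) : ↥(unipotentRadicalGL F (id : Fin 3 → Fin 3))) : GL (Fin 3) F) * ((blockDiagonalGL F (![0, 0, 1] : Fin 3 → Fin 2)) (ι g) : GL (Fin 3) F)) ∂μ = 0)
    {p : GL (Fin 3) F} (hp : p ∈ (standardParabolicGL F (![0, 0, 1] : Fin 3 → Fin 2))) :
    ∫ y, f.toFun ((permGL (Equiv.swap (1 : Fin 3) 2) : GL (Fin 3) F) * ((e ((0, y), 0) : ↥(unipotentRadicalGL F (id : Fin 3 → Fin 3))) : GL (Fin 3) F) * p) ∂μ = 0 := by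
  haveI : IsTopologicalRing F := inferInstance
  obtain ⟨C, -, hC⟩ := exists_borelMultiplier μ χ e he
  -- `p = u · diag(m)`, `u ∈ U_P ≤ U₃`, `m = levi p = z · ι g`
  set m := leviProjection F (![0, 0, 1] : Fin 3 → Fin 2) ⟨p, hp⟩ with hm_def
  have hu : p * (blockDiagonalGL F (![0, 0, 1] : Fin 3 → Fin 2) m)⁻¹ ∈ upperUnitriangular (Fin 3) F := by
    refine unipotentRadicalGL_le_upperUnitriangular (![0, 0, 1] : Fin 3 → Fin 2) K2E3GL3MaximalParabolicRelabel.monotone_twoOne ⟨⟨p, hp⟩ * (leviEmbeddingP F (![0, 0, 1] : Fin 3 → Fin 2) m)⁻¹, (MonoidHom.mem_ker).2 ?_, ?_⟩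
    · rw [map_mul, map_inv, hm_def, leviProjection_leviEmbeddingP_apply, mul_inv_cancel]
    · simp only [Subgroup.coe_subtype, Subgroup.coe_mul, Subgroup.coe_inv, coe_leviEmbeddingP]
  obtain ⟨g, z, hzB, hmz⟩ := exists_eq_mul_iota ι hι m
  have hp' : ∀ y : F, (permGL (Equiv.swap (1 : Fin 3) 2) : GL (Fin 3) F) * ((e ((0, y), 0) : ↥(unipotentRadicalGL F (id : Fin 3 → Fin 3))) : GL (Fin 3) F) * p =
      (permGL (Equiv.swap (1 : Fin 3) 2) : GL (Fin 3) F) * ((e ((0, y), 0) : ↥(unipotentRadicalGL F (id : Fin 3 → Fin 3))) : GL (Fin 3) F) * (p * (blockDiagonalGL F (![0, 0, 1] : Fin 3 → Fin 2) m)⁻¹) * ((blockDiagonalGL F (![0, 0, 1] : Fin 3 → Fin 2) z : GL (Fin 3) F) * ((blockDiagonalGL F (![0, 0, 1] : Fin 3 → Fin 2)) (ι g) : GL (Fin 3) F)) := fun y => by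
    rw [← map_mul, ← hmz]; group
  simp only [hp']
  rw [integral_middleCellFun_mul_unipotent μ χ e he f hu, hC f ⟨_, hzB⟩ _, hzero g, mul_zero]

set_option maxHeartbeats 3000000 in  -- `parabolicIndGL F id (𝟙.twist χ)` vs `smoothIndRep B₃ σ′` (definitional unfolding of the consumer's currency, no search)
/-- **LETTER L1 OF ★ E4b-3 (the middle `(B, P_{(2,1)})`-cell), BYTE FOR BYTE.**  For every continuous block embedding `ι : GL₂(F) →* M_{(2,1)}` with `diag(ι g) = diag(g,1)` and
every subrepresentation `J₁` of `r_{(2,1)}(Ind_{B₃}^{GL₃} χδ^{1∕2})` consisting of the classes of functions vanishing on `P_{(2,1)}`: there are a character `χ₂` of the diagonal torus of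
`GL₂(F)` and a linear map `Ψ : J₁ → Ind_{B₂}^{GL₂}(χ₂ δ^{1∕2})` which is `GL₂`-EQUIVARIANT through `ι` and whose KERNEL consists of classes of functions vanishing on
`Z = {g : g₁₀g₂₁ − g₁₁g₂₀ = 0}` — `Ψ[f](g) = ∫_F f(s₂ · x₁₂(y) · diag(ι g)) dy` (★ file 2), kernel by compact-open averaging inside `U_P` (★ file 3b).
[cite: BernsteinZelevinsky1977, Thm. 5.2] [cite: Casselman1995, §6.3, Thm. 6.3.5] -/
theorem exists_middleCellMap (χ : (Π a : Fin 3, GL {i : Fin 3 // (id : Fin 3 → Fin 3) i = a} F) →* ℂˣ) :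
    ∀ ι : GL (Fin 2) F →* (Π a, GL {i // (![0, 0, 1] : Fin 3 → Fin 2) i = a} F),
      (∀ g : GL (Fin 2) F, ((blockDiagonalGL F (![0, 0, 1] : Fin 3 → Fin 2) (ι g) : GL (Fin 3) F) : Matrix (Fin 3) (Fin 3) F) =
          !![(g : Matrix (Fin 2) (Fin 2) F) 0 0, (g : Matrix (Fin 2) (Fin 2) F) 0 1, 0;
             (g : Matrix (Fin 2) (Fin 2) F) 1 0, (g : Matrix (Fin 2) (Fin 2) F) 1 1, 0;
             0, 0, 1]) → Continuous ι →
      ∀ J₁ : Subrepresentation (jacquetGL F (![0, 0, 1] : Fin 3 → Fin 2) (parabolicIndGL F (id : Fin 3 → Fin 3)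
          ((Representation.trivial ℂ (Π a : Fin 3, GL {i : Fin 3 // (id : Fin 3 → Fin 3) i = a} F) ℂ).twist χ))),
        (∀ x, x ∈ J₁ ↔ ∃ f ∈ vanishingOn (standardParabolicGL F (id : Fin 3 → Fin 3))
            (Representation.twist (((Representation.trivial ℂ (Π a : Fin 3, GL {i : Fin 3 // (id : Fin 3 → Fin 3) i = a} F) ℂ).twist χ).comp
              (leviProjection F (id : Fin 3 → Fin 3))) (rootDeltaChar (standardParabolicGL F (id : Fin 3 → Fin 3))))
            (standardParabolicGL F (![0, 0, 1] : Fin 3 → Fin 2) : Set (GL (Fin 3) F)),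
            Coinvariants.mk (restrictUnipotentGL F (![0, 0, 1] : Fin 3 → Fin 2) (parabolicIndGL F (id : Fin 3 → Fin 3)
              ((Representation.trivial ℂ (Π a : Fin 3, GL {i : Fin 3 // (id : Fin 3 → Fin 3) i = a} F) ℂ).twist χ))) f = x) →
        ∃ (χ₂ : (Π a : Fin 2, GL {i : Fin 2 // (id : Fin 2 → Fin 2) i = a} F) →* ℂˣ)
          (Ψ : J₁.toSubmodule →ₗ[ℂ]
            SmoothInd (standardParabolicGL F (id : Fin 2 → Fin 2))
              (Representation.twist (((Representation.trivial ℂ (Π a : Fin 2, GL {i : Fin 2 // (id : Fin 2 → Fin 2) i = a} F) ℂ).twist χ₂).comp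
                (leviProjection F (id : Fin 2 → Fin 2))) (rootDeltaChar (standardParabolicGL F (id : Fin 2 → Fin 2))))),
          (∀ (g : GL (Fin 2) F) (a : J₁.toSubmodule),
            Ψ ⟨jacquetGL F (![0, 0, 1] : Fin 3 → Fin 2) (parabolicIndGL F (id : Fin 3 → Fin 3)
              ((Representation.trivial ℂ (Π a : Fin 3, GL {i : Fin 3 // (id : Fin 3 → Fin 3) i = a} F) ℂ).twist χ)) (ι g)
                (a : (restrictUnipotentGL F (![0, 0, 1] : Fin 3 → Fin 2) (parabolicIndGL F (id : Fin 3 → Fin 3)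
                  ((Representation.trivial ℂ (Π a : Fin 3, GL {i : Fin 3 // (id : Fin 3 → Fin 3) i = a} F) ℂ).twist χ))).Coinvariants),
              J₁.apply_mem_toSubmodule (ι g) a.2⟩ =
            (parabolicIndGL F (id : Fin 2 → Fin 2)
              ((Representation.trivial ℂ (Π a : Fin 2, GL {i : Fin 2 // (id : Fin 2 → Fin 2) i = a} F) ℂ).twist χ₂)) g (Ψ a)) ∧
          ∀ a : J₁.toSubmodule, Ψ a = 0 → ∃ f ∈ vanishingOn (standardParabolicGL F (id : Fin 3 → Fin 3))
            (Representation.twist (((Representation.trivial ℂ (Π a : Fin 3, GL {i : Fin 3 // (id : Fin 3 → Fin 3) i = a} F) ℂ).twist χ).comp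
              (leviProjection F (id : Fin 3 → Fin 3))) (rootDeltaChar (standardParabolicGL F (id : Fin 3 → Fin 3))))
            {g : GL (Fin 3) F | (g : Matrix (Fin 3) (Fin 3) F) 1 0 * (g : Matrix (Fin 3) (Fin 3) F) 2 1 -
              (g : Matrix (Fin 3) (Fin 3) F) 1 1 * (g : Matrix (Fin 3) (Fin 3) F) 2 0 = 0},
            Coinvariants.mk (restrictUnipotentGL F (![0, 0, 1] : Fin 3 → Fin 2) (parabolicIndGL F (id : Fin 3 → Fin 3)
              ((Representation.trivial ℂ (Π a : Fin 3, GL {i : Fin 3 // (id : Fin 3 → Fin 3) i = a} F) ℂ).twist χ))) f =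
              (a : (restrictUnipotentGL F (![0, 0, 1] : Fin 3 → Fin 2) (parabolicIndGL F (id : Fin 3 → Fin 3)
                ((Representation.trivial ℂ (Π a : Fin 3, GL {i : Fin 3 // (id : Fin 3 → Fin 3) i = a} F) ℂ).twist χ))).Coinvariants) := by
  intro ι hι hιc J₁ hJ₁
  haveI : IsTopologicalRing F := inferInstance
  haveI : T2Space F := (isLocalField F).toT2Space
  haveI : LocallyCompactSpace F := (isLocalField F).toLocallyCompactSpace
  letI : MeasurableSpace F := borel F
  haveI : BorelSpace F := ⟨rfl⟩
  let μ : Measure F := Measure.addHaar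
  obtain ⟨e, he⟩ := exists_coordHomeomorph (R := F)
  obtain ⟨χ₂, Ψ, hval, hequiv⟩ := exists_middleCellMap_formula μ χ e he ι hι hιc J₁ hJ₁
  refine ⟨χ₂, Ψ, fun g a => hequiv g a, fun a hΨa => ?_⟩
  obtain ⟨f, hf, hfa⟩ := (hJ₁ _).1 a.2
  have ha : (⟨Representation.Coinvariants.mk (restrictUnipotentGL F (![0, 0, 1] : Fin 3 → Fin 2) (smoothIndRep (standardParabolicGL F (id : Fin 3 → Fin 3)) (Representation.twist (((Representation.trivial ℂ (Π a : Fin 3, GL {i : Fin 3 // (id : Fin 3 → Fin 3) i = a} F) ℂ).twist χ).comp (leviProjection F (id : Fin 3 → Fin 3))) (rootDeltaChar (standardParabolicGL F (id : Fin 3 → Fin 3)))))) f, (hJ₁ _).2 ⟨f, hf, rfl⟩⟩ : ↥J₁.toSubmodule) = a := Subtype.ext hfa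
  have hzero : ∀ g : GL (Fin 2) F, ∫ y, f.toFun ((permGL (Equiv.swap (1 : Fin 3) 2) : GL (Fin 3) F) * ((e ((0, y), 0) : ↥(unipotentRadicalGL F (id : Fin 3 → Fin 3))) : GL (Fin 3) F) * ((blockDiagonalGL F (![0, 0, 1] : Fin 3 → Fin 2)) (ι g) : GL (Fin 3) F)) ∂μ = 0 := fun g => by
    rw [← hval f hf g]
    erw [ha, hΨa]
    rfl
  obtain ⟨f₂, hf₂, hmk⟩ := exists_mem_vanishingOn_minor_of_integral_eq_zero μ χ e he f hf
    (fun p hp => integral_middleCellFun_eq_zero_of_blockMap μ χ e he ι hι f hzero hp)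
  exact ⟨f₂, hf₂, hmk.trans hfa⟩

end Summit.HodgeConjecture.HodgeConjecture.Cruxes.H413.K2E3GL3BorelInducedJacquetQMiddleCell

end
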